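import Summits.Ventures.LatticeQCDFlow.Scaling.FlowLadderEquivariantCeiling
import Summits.Ventures.LatticeQCDFlow.Scaling.FlowTemperingConjugacy
import Summits.Ventures.LatticeQCDFlow.Scaling.SimulatedTemperingModeTorpid

/-!
HONEST FRAMING: exact (Metropolis-corrected) sampling algorithms for lattice gauge theory; figures
of merit are autocorrelation/cost numbers at stated couplings and volumes; no continuum-physics
claim.

# FlowTemperingEquivariantCeiling — THE TEMPERING TWIN OF `Scaling/FlowLadderEquivariantCeiling`: TRANSPORT MOVES THAT
# CARRY A FAMILY OF SETS ALONG THE LADDER (`A_{j+1} = φ_j(A_j)`) NEVER LEAVE "SOME LEVEL, ITS SET", SO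
# `Gap(stFlowSampler t μ M φ) ≤ (1−t)(K+1)·Σ_kQ_k(A_k,A_kᶜ)/(m_A((K+1) − m_A))`, `m_A = Σ_kμ_k(A_k)` — THE CEILING OF
# `Scaling/SimulatedTemperingFlowTorpid` WITHOUT THE SECTOR-PRESERVING HYPOTHESIS (lean-2 GEN-21, ours)

Venture-side (OURS).  Cell `lqcd-flow` (pub-lqcd), unit `pub-lqcd-lean-2-g21`, 2026-08-26.  Chapter I, twelfth file.
`Scaling/SimulatedTemperingFlowTorpid` (F4) proved the tempering no-go for SECTOR-PRESERVING transport maps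
(`φ_j(A) = A`).  In the level coordinates `(k, x) ↦ (k, L_k x)` of `Scaling/FlowTemperingConjugacy` the sampler with
transport maps `φ_j = L_{j+1}⁻¹∘L_j` IS the plain tempering sampler for the pulled-back laws, whose sector ceiling
(`Scaling/SimulatedTemperingModeTorpid`, Y4, for ONE set `B` at every level) pulls back to a ceiling for the LEVEL-DEPENDENT
family `A_k = L_k⁻¹(B)` — exactly the families carried by the maps, `A_{j+1} = φ_j(A_j)` (same sector, another sector, any
relabelled image).  The bookkeeping lemmas are those of `Scaling/FlowLadderEquivariantCeiling`.

## What is proved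

* **`flowTempering_spectralGap_le_imageFamily`** (level coordinates, one set `B`, images `A_k = L_k⁻¹B`);
  **`flowTemperingEquivariant_spectralGap_le`** — for EVERY `φ` and every `φ`-equivariant family with
  `0 < m_A < K+1`: `Gap(stFlowSampler t μ M φ) ≤ (1−t)(K+1)·Σ_kQ_k(A_k,A_kᶜ)/(m_A((K+1) − m_A))`;
  **`flowTemperingEquivariant_spectralGap_le_of_frozen`** — no level's own update leaves its set (`Q_k(A_k,A_kᶜ) = 0`
  for all `k`): `Gap ≤ 0`, the sampler with transport moves is not even ergodic in rate — whatever the maps.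

Reading (no numerics implied): as for replica exchange, a tempering transport map helps across a topological barrier only if
it carries one level's sector into several sectors' basins at the next; level-by-level bijections between (relabelled)
sectors leave the sector content to the within-level updates.  NOT CLAIMED: floors for sector-mixing maps; continuous
spaces; anything measured.  Literature grade (cell rule): OWN MECHANISM, NEW TYPING; nothing cited as a fact; no new bib
keys.
-/

noncomputable section

open Finset Function
open Literature.Probability.MarkovChains

namespace Summit.Ventures.LatticeQCDFlow.Scaling

variable {S : Type*} [Fintype S] [DecidableEq S] {K : ℕ} {μ : Fin (K + 1) → S → ℝ}
  {M : Fin (K + 1) → Matrix S S ℝ} {t : ℝ}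

/-- **THE IMAGE-FAMILY CEILING FOR TEMPERING IN LEVEL COORDINATES:** level bijections `L`, one set `B`, images
`A_k = L_k⁻¹(B)`, `m_A = Σ_kμ_k(A_k)` with `0 < m_A < K+1` (`0 ≤ t ≤ 1`):
`Gap(stFlowSampler t μ M φ^L) ≤ (1−t)(K+1)·Σ_kQ_k(A_k,A_kᶜ)/(m_A((K+1) − m_A))`. [ours] -/
theorem flowTempering_spectralGap_le_imageFamily (L : Fin (K + 1) → Equiv.Perm S) (B : Finset S)
    (hμ : ∀ k x, 0 < μ k x) (hμ1 : ∀ k, ∑ x, μ k x = 1) (hM : ∀ k, IsRowStochastic (M k))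
    (hMrev : ∀ k, DetailedBalance (μ k) (M k)) (ht0 : 0 ≤ t) (ht1 : t ≤ 1)
    (hA0 : 0 < ∑ k, ∑ x ∈ B.map (L k).symm.toEmbedding, μ k x)
    (hA1 : ∑ k, ∑ x ∈ B.map (L k).symm.toEmbedding, μ k x < K + 1) :
    spectralGap (stFinLaw μ) (stFlowSampler t μ M (fun j : Fin K => (L j.castSucc).trans (L j.succ).symm))
      ≤ (1 - t) * (K + 1) * (∑ k, edgeMeasure (μ k) (M k) (B.map (L k).symm.toEmbedding) (B.map (L k).symm.toEmbedding)ᶜ)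
          / ((∑ k, ∑ x ∈ B.map (L k).symm.toEmbedding, μ k x)
              * ((K + 1) - ∑ k, ∑ x ∈ B.map (L k).symm.toEmbedding, μ k x)) := by
  rw [stFlowSampler_spectralGap_eq_conj L hμ t M]
  have hmass : ∀ k : Fin (K + 1), ∑ x ∈ B, μ k ((L k).symm x) = ∑ x ∈ B.map (L k).symm.toEmbedding, μ k x :=
    fun k => sum_relabel_set (L k).symm B (μ k)
  have hedge : ∀ k : Fin (K + 1), edgeMeasure (fun u => μ k ((L k).symm u))
      (Matrix.of fun u v => M k ((L k).symm u) ((L k).symm v)) B Bᶜ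
      = edgeMeasure (μ k) (M k) (B.map (L k).symm.toEmbedding) (B.map (L k).symm.toEmbedding)ᶜ := fun k => by
    have h := edgeMeasure_relabel_set (L k).symm (μ k) (M k) B Bᶜ
    rw [← map_compl_equiv] at h
    exact h
  have hA0' : 0 < ∑ k, ∑ x ∈ B, μ k ((L k).symm x) := by simp only [hmass]; exact hA0
  have hA1' : ∑ k, ∑ x ∈ B, μ k ((L k).symm x) < K + 1 := by simp only [hmass]; exact hA1
  have h := stFin_spectralGap_le_sector (μ := fun i u => μ i ((L i).symm u))
    (M := fun i => Matrix.of fun u v => M i ((L i).symm u) ((L i).symm v)) (t := t) (fun k u => hμ k _)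
    (fun k => by rw [Equiv.sum_comp (L k).symm (μ k)]; exact hμ1 k)
    (fun k => ⟨fun u v => (hM k).1 _ _,
      fun u => by simpa using (Equiv.sum_comp (L k).symm (fun v => M k ((L k).symm u) v)).trans ((hM k).2 _)⟩)
    (fun k u v => by simp only [Matrix.of_apply]; exact hMrev k _ _) ht0 ht1 B hA0' hA1'
  simp only [hmass, hedge] at h
  exact h

/-- **TRANSPORT MOVES THAT CARRY A FAMILY OF SETS ALONG THE LADDER DO NOT TUNNEL OUT OF IT:** for EVERY family of adjacent
bijections `φ` and every `φ`-equivariant family (`A_{j+1} = φ_j(A_j)`) with `0 < m_A = Σ_kμ_k(A_k) < K+1` (`0 ≤ t ≤ 1`):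
`Gap(stFlowSampler t μ M φ) ≤ (1−t)(K+1)·Σ_kQ_k(A_k,A_kᶜ)/(m_A((K+1) − m_A))`. [ours] -/
theorem flowTemperingEquivariant_spectralGap_le (φ : Fin K → Equiv.Perm S) (A : Fin (K + 1) → Finset S)
    (hAφ : ∀ j : Fin K, A j.succ = (A j.castSucc).map (φ j).toEmbedding)
    (hμ : ∀ k x, 0 < μ k x) (hμ1 : ∀ k, ∑ x, μ k x = 1) (hM : ∀ k, IsRowStochastic (M k))
    (hMrev : ∀ k, DetailedBalance (μ k) (M k)) (ht0 : 0 ≤ t) (ht1 : t ≤ 1)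
    (hA0 : 0 < ∑ k, ∑ x ∈ A k, μ k x) (hA1 : ∑ k, ∑ x ∈ A k, μ k x < K + 1) :
    spectralGap (stFinLaw μ) (stFlowSampler t μ M φ)
      ≤ (1 - t) * (K + 1) * (∑ k, edgeMeasure (μ k) (M k) (A k) (A k)ᶜ)
          / ((∑ k, ∑ x ∈ A k, μ k x) * ((K + 1) - ∑ k, ∑ x ∈ A k, μ k x)) := by
  obtain ⟨L, hL0, hLφ⟩ := exists_levelMaps φ
  have hφ : φ = fun j : Fin K => (L j.castSucc).trans (L j.succ).symm := (funext hLφ).symm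
  have hAk : ∀ k : Fin (K + 1), A k = (A 0).map (L k).symm.toEmbedding := by
    intro k
    induction k using Fin.induction with
    | zero =>
      rw [hL0]
      ext u
      simp
    | succ j ih => rw [hAφ j, ih, imageFamily_succ L φ hLφ (A 0) j]
  have h := flowTempering_spectralGap_le_imageFamily (t := t) (M := M) L (A 0) hμ hμ1 hM hMrev ht0 ht1
    (by simp only [← hAk]; exact hA0) (by simp only [← hAk]; exact hA1)
  simp only [← hAk] at h
  rw [hφ]
  exact h

/-- **IF NO LEVEL'S OWN UPDATE LEAVES ITS SET, THE SAMPLER WITH TRANSPORT MOVES IS NOT EVEN ERGODIC IN RATE:**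
`Q_k(A_k,A_kᶜ) = 0` for all `k` ⇒ `Gap(stFlowSampler t μ M φ) ≤ 0` — for EVERY family of maps carrying `(A_k)`. [ours] -/
theorem flowTemperingEquivariant_spectralGap_le_of_frozen (φ : Fin K → Equiv.Perm S) (A : Fin (K + 1) → Finset S)
    (hAφ : ∀ j : Fin K, A j.succ = (A j.castSucc).map (φ j).toEmbedding)
    (hμ : ∀ k x, 0 < μ k x) (hμ1 : ∀ k, ∑ x, μ k x = 1) (hM : ∀ k, IsRowStochastic (M k))
    (hMrev : ∀ k, DetailedBalance (μ k) (M k)) (ht0 : 0 ≤ t) (ht1 : t ≤ 1)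
    (hA0 : 0 < ∑ k, ∑ x ∈ A k, μ k x) (hA1 : ∑ k, ∑ x ∈ A k, μ k x < K + 1)
    (hfrozen : ∀ k : Fin (K + 1), edgeMeasure (μ k) (M k) (A k) (A k)ᶜ = 0) :
    spectralGap (stFinLaw μ) (stFlowSampler t μ M φ) ≤ 0 := by
  have h := flowTemperingEquivariant_spectralGap_le φ A hAφ hμ hμ1 hM hMrev ht0 ht1 hA0 hA1
  have h0 : ∑ k : Fin (K + 1), edgeMeasure (μ k) (M k) (A k) (A k)ᶜ = 0 := Finset.sum_eq_zero fun k _ => hfrozen k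
  rw [h0, mul_zero, zero_div] at h
  exact h

end Summit.Ventures.LatticeQCDFlow.Scaling

end
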